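import Mathlib
import Summits.FinalStateConjecture.FinalStateConjecture.Theorems.LaminatedThresholdCombLemmaAdapted

/-!
# The comb lemma for an orientation-reversing unstable multiplier (crux `LaminatedThreshold`)

`Comb.comb_lemma_adapted` (`LaminatedThresholdCombLemmaAdapted.lean`) produces the two-sided comb of
preimage sheets from TWO transverse seeds, one on each half of the `T`-invariant unstable axis, for
an unstable multiplier `1 < μ`. When the multiplier is orientation-REVERSING, `μ < -1`, the two
half-axes are exchanged by `T`, and ONE transverse seed `(σ₁, G₁)`, `0 < σ₁`, suffices: its
pull-back `G₁ ∘ T` through the axis preimage `σ₂ < 0` of `σ₁` is a transverse seed on the other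
half-axis for the orientation-preserving map `T ∘ T` (multiplier `μ² > 1`, contraction `S ∘ S`),
and the trichotomy of `comb_lemma_adapted` for `T ∘ T` collapses to a DICHOTOMY for `T`: every
`K`-level orbit either stays `ε`-close to the fixed point or hits the single seed sheet `{G₁ = 0}`
near `(0, σ₁)`; the level set `K ∋ 0` still accumulates at `0` from both sides.

This is statement `P2` (`comb_lemma_flip`) of the crux idea `Ideas/flip-echo.md`
(crux `LaminatedThreshold`, round 2): the two opposite-side seeds and the two-sidedness that the
adapted comb lemma needs as input come from a single seed once the unstable Floquet multiplier is
negative.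
-/

set_option linter.dupNamespace false

namespace Summit.FinalStateConjecture.FinalStateConjecture.Theorems.LaminatedThreshold.Comb

open Set Function Filter Topology Metric

/-- Norm of a point of the vertical axis of `E × ℝ` (sup norm). [folklore] -/
theorem norm_axis_point {E : Type*} [SeminormedAddCommGroup E] (t : ℝ) :
    ‖((0 : E), t)‖ = |t| := by
  simp [Prod.norm_def]

/-- Even iterates of `T` are iterates of `T ∘ T`. [folklore] -/
theorem iterate_two_mul_apply {α : Type*} (T : α → α) (k : ℕ) (p : α) :
    T^[2 * k] p = (T ∘ T)^[k] p := by
  rw [Function.iterate_mul]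
  rfl

/-- **The comb lemma for a flip multiplier** (`P2` of `Ideas/flip-echo.md`): the binder structure
of `comb_lemma_adapted` with `1 < μ` replaced by `μ < -1`, ONE transverse seed on the positive
half-axis, and a dichotomy in the conclusion. Proof: `comb_lemma_adapted` for `T ∘ T` with the
second seed `(σ₂, G₁ ∘ T)`, `σ₂ < 0` the axis preimage of `σ₁`. [folklore] -/
theorem comb_lemma_flip : ∀ (E : Type) [NormedAddCommGroup E] [NormedSpace ℝ E] [CompleteSpace E] (T : E × ℝ → E × ℝ) (S : E →L[ℝ] E) (μ r₀ : ℝ), T 0 = 0 → 0 < r₀ → ContDiffOn ℝ 1 T (Metric.ball 0 r₀) → HasFDerivAt T ((S.comp (ContinuousLinearMap.fst ℝ E ℝ)).prod (μ • ContinuousLinearMap.snd ℝ E ℝ)) 0 → ‖S‖ < 1 → μ < -1 → (∀ t : ℝ, |t| < r₀ → (T ((0 : E), t)).1 = 0) → ∃ r₁ : ℝ, 0 < r₁ ∧ ∀ (σ₁ : ℝ) (G₁ : E × ℝ → ℝ), 0 < σ₁ ∧ σ₁ < r₁ ∧ (∃ r' : ℝ, 0 < r' ∧ ContDiffOn ℝ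 1 G₁ (Metric.ball ((0 : E), σ₁) r')) ∧ G₁ ((0 : E), σ₁) = 0 ∧ fderiv ℝ G₁ ((0 : E), σ₁) ((0 : E), (1 : ℝ)) ≠ 0 → ∀ ε : ℝ, 0 < ε → ∃ ρ : ℝ, 0 < ρ ∧ ∃ (Φ : E × ℝ → ℝ) (K : Set ℝ), Φ 0 = 0 ∧ (0 : ℝ) ∈ K ∧ (∀ η : ℝ, 0 < η → (K ∩ Set.Ioo (0 - η) 0).Nonempty ∧ (K ∩ Set.Ioo 0 (0 + η)).Nonempty) ∧ ContinuousOn Φ (Metric.ball 0 ρ) ∧ ∀ p ∈ Metric.ball (0 : E × ℝ) ρ, Φ p ∈ K → ((∀ n : ℕ, T^[n] p ∈ Metric.ball (0 : E × ℝ) ε) ∨ (∃ n : ℕ, T^[n] p ∈ Metric.ball ((0 : E), σ₁) ε ∧ G₁ (T^[n] p) = 0)) := by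
  intro E _ _ _ T S μ r₀ hT0 hr₀ hTC1 hDT0 hS hμ haxis
  set L : E × ℝ →L[ℝ] E × ℝ :=
    (S.comp (ContinuousLinearMap.fst ℝ E ℝ)).prod (μ • ContinuousLinearMap.snd ℝ E ℝ) with hL
  have hTcont : ContinuousOn T (ball 0 r₀) := hTC1.continuousOn
  have hT0c : ContinuousAt T 0 := hDT0.continuousAt
  -- a radius on which `T` maps into the `C¹` ball
  obtain ⟨r₀', hr₀', hr₀'le, hmap⟩ : ∃ r₀' : ℝ, 0 < r₀' ∧ r₀' ≤ r₀ ∧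
      MapsTo T (ball (0 : E × ℝ) r₀') (ball 0 r₀) := by
    obtain ⟨δ, hδ, hδT⟩ := Metric.continuousAt_iff.1 hT0c r₀ hr₀
    refine ⟨min δ r₀, lt_min hδ hr₀, min_le_right _ _, fun x hx ↦ ?_⟩
    have h := hδT (lt_of_lt_of_le (mem_ball.1 hx) (min_le_left _ _))
    rwa [hT0, ← mem_ball] at h
  have hsub' : ball (0 : E × ℝ) r₀' ⊆ ball 0 r₀ := ball_subset_ball hr₀'le
  -- `T ∘ T` satisfies the hypotheses of the adapted comb lemma
  have hT20 : (T ∘ T) 0 = 0 := by simp [hT0]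
  have hT2C1 : ContDiffOn ℝ 1 (T ∘ T) (ball 0 r₀') := hTC1.comp (hTC1.mono hsub') hmap
  have hLL : L.comp L = ((S.comp S).comp (ContinuousLinearMap.fst ℝ E ℝ)).prod
      ((μ * μ) • ContinuousLinearMap.snd ℝ E ℝ) := by
    refine ContinuousLinearMap.ext fun x ↦ ?_
    simp [hL, mul_assoc]
  have hDT20 : HasFDerivAt (T ∘ T) (((S.comp S).comp (ContinuousLinearMap.fst ℝ E ℝ)).prod
      ((μ * μ) • ContinuousLinearMap.snd ℝ E ℝ)) 0 := by
    have h1 : HasFDerivAt T L (T 0) := by rw [hT0]; exact hDT0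
    have h2 : HasFDerivAt (T ∘ T) (L.comp L) 0 := h1.comp 0 hDT0
    rwa [hLL] at h2
  have hS2 : ‖S.comp S‖ < 1 :=
    (S.opNorm_comp_le S).trans_lt (mul_lt_one_of_nonneg_of_lt_one_left (norm_nonneg _) hS hS.le)
  have hμ2 : 1 < μ * μ := by nlinarith
  have hsnd_abs : ∀ q : E × ℝ, |q.2| ≤ ‖q‖ := fun q ↦ by
    have h := norm_snd_le q
    rwa [Real.norm_eq_abs] at h
  have haxis_pt : ∀ t : ℝ, |t| < r₀ → T ((0 : E), t) = ((0 : E), (T ((0 : E), t)).2) :=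
    fun t ht ↦ Prod.ext (haxis t ht) rfl
  have hmem_axis : ∀ {t r : ℝ}, |t| < r → ((0 : E), t) ∈ ball (0 : E × ℝ) r := fun ht ↦ by
    rwa [mem_ball, dist_zero_right, norm_axis_point]
  have haxis2 : ∀ t : ℝ, |t| < r₀' → ((T ∘ T) ((0 : E), t)).1 = 0 := by
    intro t ht
    have hTt : T ((0 : E), t) ∈ ball (0 : E × ℝ) r₀ := hmap (hmem_axis ht)
    show (T (T ((0 : E), t))).1 = 0
    rw [haxis_pt t (lt_of_lt_of_le ht hr₀'le)]
    refine haxis _ (lt_of_le_of_lt (hsnd_abs _) ?_)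
    rwa [mem_ball, dist_zero_right] at hTt
  obtain ⟨r₁, hr₁, Hcomb⟩ :=
    comb_lemma_adapted E (T ∘ T) (S.comp S) (μ * μ) r₀' hT20 hr₀' hT2C1 hDT20 hS2 hμ2 haxis2
  -- the axis map `τ`
  set τ : ℝ → ℝ := fun t ↦ (T ((0 : E), t)).2 with hτ
  have hτ0 : τ 0 = 0 := by
    show (T ((0 : E), (0 : ℝ))).2 = 0
    rw [show ((0 : E), (0 : ℝ)) = (0 : E × ℝ) from rfl, hT0]
    rfl
  have hι : ContDiff ℝ 1 (fun t : ℝ ↦ ((0 : E), t)) := contDiff_const.prodMk contDiff_id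
  have hιmap : MapsTo (fun t : ℝ ↦ ((0 : E), t)) (Ioo (-r₀') r₀') (ball (0 : E × ℝ) r₀) := by
    intro t ht
    exact hsub' (hmem_axis (abs_lt.2 ⟨ht.1, ht.2⟩))
  have hτC1 : ContDiffOn ℝ 1 τ (Ioo (-r₀') r₀') := by
    have h := contDiff_snd (𝕜 := ℝ) (E := E) (F := ℝ) |>.comp_contDiffOn
      (hTC1.comp hι.contDiffOn hιmap)
    exact h
  have hτcont : ContinuousOn τ (Ioo (-r₀') r₀') := hτC1.continuousOn
  have hτdiff : ∀ t ∈ Ioo (-r₀') r₀', DifferentiableAt ℝ τ t := fun t ht ↦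
    (hτC1.differentiableOn one_ne_zero t ht).differentiableAt (isOpen_Ioo.mem_nhds ht)
  have hdτcont : ContinuousOn (deriv τ) (Ioo (-r₀') r₀') :=
    hτC1.continuousOn_deriv_of_isOpen isOpen_Ioo le_rfl
  have h0mem : (0 : ℝ) ∈ Ioo (-r₀') r₀' := ⟨by linarith, hr₀'⟩
  have hτderiv0 : HasDerivAt τ μ 0 := by
    have h1 : HasDerivAt (fun t : ℝ ↦ ((0 : E), t)) ((0 : E), (1 : ℝ)) 0 :=
      (hasDerivAt_const (0 : ℝ) (0 : E)).prodMk (hasDerivAt_id (0 : ℝ))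
    have h2 : HasDerivAt (T ∘ fun t : ℝ ↦ ((0 : E), t)) (L ((0 : E), (1 : ℝ))) 0 :=
      hDT0.comp_hasDerivAt_of_eq 0 h1 rfl
    have h3 : HasDerivAt (Prod.snd ∘ T ∘ fun t : ℝ ↦ ((0 : E), t))
        ((ContinuousLinearMap.snd ℝ E ℝ) (L ((0 : E), (1 : ℝ)))) 0 :=
      (ContinuousLinearMap.snd ℝ E ℝ).hasFDerivAt.comp_hasDerivAt 0 h2
    refine h3.congr_deriv ?_
    simp [hL]
  have hdτ0 : deriv τ 0 = μ := hτderiv0.deriv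
  -- a radius `a` on which `τ` is strictly decreasing with `deriv τ < μ / 2`
  obtain ⟨a, ha, har₀', har₁, hda⟩ : ∃ a : ℝ, 0 < a ∧ a ≤ r₀' ∧ a ≤ r₁ ∧
      ∀ t : ℝ, |t| < a → deriv τ t < μ / 2 := by
    have hc : ContinuousAt (deriv τ) 0 := hdτcont.continuousAt (isOpen_Ioo.mem_nhds h0mem)
    obtain ⟨δ, hδ, hδd⟩ := Metric.continuousAt_iff.1 hc (-(μ / 2)) (by linarith)
    refine ⟨min δ (min r₀' r₁), lt_min hδ (lt_min hr₀' hr₁),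
      (min_le_right _ _).trans (min_le_left _ _), (min_le_right _ _).trans (min_le_right _ _),
      fun t ht ↦ ?_⟩
    have hdist : dist t 0 < δ := by
      rw [dist_zero_right, Real.norm_eq_abs]; exact lt_of_lt_of_le ht (min_le_left _ _)
    have h := hδd hdist
    rw [hdτ0, Real.dist_eq] at h
    linarith [(abs_lt.1 h).2]
  have hIoo_a : Ioo (-a) a ⊆ Ioo (-r₀') r₀' := Ioo_subset_Ioo (by linarith) har₀'
  have hanti : StrictAntiOn τ (Ioo (-a) a) := by
    refine strictAntiOn_of_deriv_neg (convex_Ioo _ _) (hτcont.mono hIoo_a) fun t ht ↦ ?_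
    rw [interior_Ioo] at ht
    have := hda t (abs_lt.2 ⟨ht.1, ht.2⟩)
    linarith
  have hpos : 0 < τ (-(a / 2)) := by
    have h := hanti (show -(a / 2) ∈ Ioo (-a) a from ⟨by linarith, by linarith⟩)
      (show (0 : ℝ) ∈ Ioo (-a) a from ⟨by linarith, ha⟩) (by linarith : -(a / 2) < 0)
    rwa [hτ0] at h
  -- the radius of the flip lemma
  refine ⟨min r₁ (τ (-(a / 2))), lt_min hr₁ hpos, ?_⟩
  rintro σ₁ G₁ ⟨hσ₁, hσ₁r, ⟨r', hr', hG₁⟩, hG₁0, hG₁t⟩ ε hε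
  have hσ₁r₁ : σ₁ < r₁ := lt_of_lt_of_le hσ₁r (min_le_left _ _)
  have hσ₁τ : σ₁ < τ (-(a / 2)) := lt_of_lt_of_le hσ₁r (min_le_right _ _)
  -- the axis preimage `σ₂ < 0` of `σ₁`
  obtain ⟨σ₂, ⟨hσ₂lo, hσ₂0⟩, hτσ₂⟩ : ∃ σ₂ ∈ Ioo (-(a / 2)) 0, τ σ₂ = σ₁ := by
    have hIcc : Icc (-(a / 2)) 0 ⊆ Ioo (-r₀') r₀' := fun t ht ↦ ⟨by linarith [ht.1], by linarith [ht.2]⟩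
    have h := intermediate_value_Ioo' (show -(a / 2) ≤ (0 : ℝ) by linarith) (hτcont.mono hIcc)
    rw [hτ0] at h
    exact h ⟨hσ₁, hσ₁τ⟩
  have hσ₂abs_a : |σ₂| < a := abs_lt.2 ⟨by linarith, by linarith⟩
  have hσ₂abs_r₀ : |σ₂| < r₀ := lt_of_lt_of_le hσ₂abs_a (har₀'.trans hr₀'le)
  have hσ₂mem : σ₂ ∈ Ioo (-r₀') r₀' := hIoo_a (abs_lt.1 hσ₂abs_a |> fun h ↦ ⟨h.1, h.2⟩)
  have hTσ₂ : T ((0 : E), σ₂) = ((0 : E), σ₁) := Prod.ext (haxis σ₂ hσ₂abs_r₀) hτσ₂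
  have hdτσ₂ : deriv τ σ₂ ≠ 0 := by
    have := hda σ₂ hσ₂abs_a
    exact ne_of_lt (by linarith)
  have hpt_mem : ((0 : E), σ₂) ∈ ball (0 : E × ℝ) r₀ := hmem_axis hσ₂abs_r₀
  have hTcσ₂ : ContinuousAt T ((0 : E), σ₂) := hTcont.continuousAt (isOpen_ball.mem_nhds hpt_mem)
  -- the pulled-back seed `G₁ ∘ T` near `(0, σ₂)`
  obtain ⟨r'', hr'', hsub'', hmap''⟩ : ∃ r'' : ℝ, 0 < r'' ∧ ball ((0 : E), σ₂) r'' ⊆ ball (0 : E × ℝ) r₀ ∧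
      MapsTo T (ball ((0 : E), σ₂) r'') (ball ((0 : E), σ₁) r') := by
    obtain ⟨δ, hδ, hδT⟩ := Metric.continuousAt_iff.1 hTcσ₂ r' hr'
    refine ⟨min δ (r₀ / 2), lt_min hδ (by positivity), fun q hq ↦ ?_, fun q hq ↦ ?_⟩
    · rw [mem_ball, dist_zero_right]
      have h1 : dist q ((0 : E), σ₂) < r₀ / 2 := lt_of_lt_of_le (mem_ball.1 hq) (min_le_right _ _)
      have h2 : ‖((0 : E), σ₂)‖ < r₀ / 2 := by
        have hhalf : |σ₂| < a / 2 := abs_lt.2 ⟨by linarith, by linarith⟩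
        rw [norm_axis_point]; linarith [har₀'.trans hr₀'le]
      calc ‖q‖ = ‖(q - ((0 : E), σ₂)) + ((0 : E), σ₂)‖ := by rw [sub_add_cancel]
        _ ≤ ‖q - ((0 : E), σ₂)‖ + ‖((0 : E), σ₂)‖ := norm_add_le _ _
        _ < r₀ / 2 + r₀ / 2 := by rw [← dist_eq_norm]; exact add_lt_add h1 h2
        _ = r₀ := by ring
    · have h := hδT (lt_of_lt_of_le (mem_ball.1 hq) (min_le_left _ _))
      rwa [hTσ₂, ← mem_ball] at h
  have hG₂C1 : ContDiffOn ℝ 1 (fun q ↦ G₁ (T q)) (ball ((0 : E), σ₂) r'') :=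
    hG₁.comp (hTC1.mono hsub'') hmap''
  have hG₂0 : (fun q ↦ G₁ (T q)) ((0 : E), σ₂) = 0 := by
    show G₁ (T ((0 : E), σ₂)) = 0
    rw [hTσ₂]; exact hG₁0
  -- the vertical derivative of `T` on the axis is vertical
  have hTdiff : DifferentiableAt ℝ T ((0 : E), σ₂) :=
    (hTC1.differentiableOn one_ne_zero _ hpt_mem).differentiableAt (isOpen_ball.mem_nhds hpt_mem)
  have hvert : fderiv ℝ T ((0 : E), σ₂) ((0 : E), (1 : ℝ)) = ((0 : E), deriv τ σ₂) := by
    have h1 : HasDerivAt (fun s : ℝ ↦ ((0 : E), s)) ((0 : E), (1 : ℝ)) σ₂ :=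
      (hasDerivAt_const σ₂ (0 : E)).prodMk (hasDerivAt_id σ₂)
    have hc : HasDerivAt (T ∘ fun s : ℝ ↦ ((0 : E), s))
        (fderiv ℝ T ((0 : E), σ₂) ((0 : E), (1 : ℝ))) σ₂ :=
      hTdiff.hasFDerivAt.comp_hasDerivAt σ₂ h1
    have hfst : HasDerivAt (fun s : ℝ ↦ (T ((0 : E), s)).1) (0 : E) σ₂ := by
      refine (hasDerivAt_const σ₂ (0 : E)).congr_of_eventuallyEq ?_
      have hn : Ioo (-r₀) r₀ ∈ 𝓝 σ₂ := isOpen_Ioo.mem_nhds (abs_lt.1 hσ₂abs_r₀ |> fun h ↦ ⟨h.1, h.2⟩)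
      filter_upwards [hn] with s hs
      exact haxis s (abs_lt.2 ⟨hs.1, hs.2⟩)
    have hsnd : HasDerivAt τ (deriv τ σ₂) σ₂ := (hτdiff σ₂ hσ₂mem).hasDerivAt
    have hc' : HasDerivAt (T ∘ fun s : ℝ ↦ ((0 : E), s)) ((0 : E), deriv τ σ₂) σ₂ := by
      have h := hfst.prodMk hsnd
      refine h.congr_of_eventuallyEq (Eventually.of_forall fun s ↦ ?_)
      simp [hτ]
    exact hc.unique hc'
  have hG₁diff : DifferentiableAt ℝ G₁ ((0 : E), σ₁) :=
    (hG₁.differentiableOn one_ne_zero _ (mem_ball_self hr')).differentiableAt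
      (isOpen_ball.mem_nhds (mem_ball_self hr'))
  have hG₂t : fderiv ℝ (fun q ↦ G₁ (T q)) ((0 : E), σ₂) ((0 : E), (1 : ℝ)) ≠ 0 := by
    have hGd : HasFDerivAt G₁ (fderiv ℝ G₁ ((0 : E), σ₁)) (T ((0 : E), σ₂)) := by
      rw [hTσ₂]; exact hG₁diff.hasFDerivAt
    have hcomp : HasFDerivAt (fun q ↦ G₁ (T q))
        ((fderiv ℝ G₁ ((0 : E), σ₁)).comp (fderiv ℝ T ((0 : E), σ₂))) ((0 : E), σ₂) :=
      hGd.comp ((0 : E), σ₂) hTdiff.hasFDerivAt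
    rw [hcomp.fderiv, ContinuousLinearMap.comp_apply, hvert]
    have hsm : ((0 : E), deriv τ σ₂) = deriv τ σ₂ • ((0 : E), (1 : ℝ)) := by simp
    rw [hsm, ContinuousLinearMap.map_smul, smul_eq_mul]
    exact mul_ne_zero hdτσ₂ hG₁t
  -- the comb of `T ∘ T`
  have hσ₂r₁ : -r₁ < σ₂ := by linarith
  obtain ⟨δ₃, hδ₃, hδ₃T⟩ := Metric.continuousAt_iff.1 hT0c ε hε
  obtain ⟨δ₄, hδ₄, hδ₄T⟩ := Metric.continuousAt_iff.1 hTcσ₂ ε hε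
  set ε' : ℝ := min ε (min δ₃ δ₄) with hε'
  have hε'0 : 0 < ε' := lt_min hε (lt_min hδ₃ hδ₄)
  have hε'ε : ε' ≤ ε := min_le_left _ _
  have hε'₃ : ε' ≤ δ₃ := (min_le_right _ _).trans (min_le_left _ _)
  have hε'₄ : ε' ≤ δ₄ := (min_le_right _ _).trans (min_le_right _ _)
  obtain ⟨ρ, hρ, Φ, K, hΦ0, hK0, hKacc, hΦc, htri⟩ := Hcomb σ₁ σ₂ G₁ (fun q ↦ G₁ (T q))
    ⟨hσ₁, hσ₁r₁, hσ₂r₁, hσ₂0, ⟨min r' r'', lt_min hr' hr'',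
      hG₁.mono (ball_subset_ball (min_le_left _ _)),
      hG₂C1.mono (ball_subset_ball (min_le_right _ _))⟩, hG₁0, hG₁t, hG₂0, hG₂t⟩ ε' hε'0
  refine ⟨ρ, hρ, Φ, K, hΦ0, hK0, hKacc, hΦc, fun p hp hpK ↦ ?_⟩
  -- images of small balls under one more application of `T`
  have hstep0 : ∀ q ∈ ball (0 : E × ℝ) ε', T q ∈ ball (0 : E × ℝ) ε := fun q hq ↦ by
    have h := hδ₃T (lt_of_lt_of_le (mem_ball.1 hq) hε'₃)
    rwa [hT0, ← mem_ball] at h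
  have hstepσ : ∀ q ∈ ball ((0 : E), σ₂) ε', T q ∈ ball ((0 : E), σ₁) ε := fun q hq ↦ by
    have h := hδ₄T (lt_of_lt_of_le (mem_ball.1 hq) hε'₄)
    rwa [hTσ₂, ← mem_ball] at h
  rcases htri p hp hpK with hstay | ⟨n, hn, hG⟩ | ⟨n, hn, hG⟩
  · refine Or.inl fun m ↦ ?_
    obtain ⟨k, rfl | rfl⟩ := Nat.even_or_odd' m
    · rw [iterate_two_mul_apply]
      exact ball_subset_ball hε'ε (hstay k)
    · rw [iterate_succ_apply', iterate_two_mul_apply]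
      exact hstep0 _ (hstay k)
  · refine Or.inr ⟨2 * n, ?_, ?_⟩
    · rw [iterate_two_mul_apply]; exact ball_subset_ball hε'ε hn
    · rw [iterate_two_mul_apply]; exact hG
  · refine Or.inr ⟨2 * n + 1, ?_, ?_⟩
    · rw [iterate_succ_apply', iterate_two_mul_apply]; exact hstepσ _ hn
    · rw [iterate_succ_apply', iterate_two_mul_apply]; exact hG

end Summit.FinalStateConjecture.FinalStateConjecture.Theorems.LaminatedThreshold.Comb
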